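import Literature.Probability.Percolation.TargetExplorationRevealed
import HarnessLib

/-!
# The gluing defect through a stopped exploration: Gladkov's swap identity and the
# revealed-closed-cut bound

Topic `Literature/Probability/Percolation`.  Bernoulli bond percolation with an arbitrary probability
`p_e ∈ [0,1]` per edge `e` of a finite set `D` (finitary calculus `DecisionTree.PrW / Pr2W` of
`DecisionTreeWeighted.lean`), an observer `o`, a finite target ("relay") set `A` and a vertex `x`.
The GLUING DEFECT is the event `H = {o ↔ A} ∩ {o ↮ x}` (Kozma–Nitzan, arXiv:2401.12397, Conjecture 3:
its probability is what a gluing inequality must bound).  Run the exploration of the cluster of `o`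
STOPPED AT THE FIRST TARGET (`TargetExploration.lean`), with revealed set `S = S(C₁)`.  PROVED here:

* `PrW_defect_eq_Pr2W_splice` — **swap identity** (Gladkov arXiv:2408.08457 Lemma 3.1 = [GZ24, Lemma
  4.2] along the self-determined set `S`): `P(H) = P⊗P{(C₁, C₂) : C₁ →_S C₂ ∈ H}`;
* `splice_mem_defect` — on `{C₁ →_S C₂ ∈ H}` the exploration of `C₁` has reached a target `a`, and
  EITHER `a ↮ x` in the independent configuration `C₂` OR some edge revealed CLOSED by the
  exploration of `C₁` is open in `C₂` (the "revealed closed cut" `Z(C₁) = S(C₁) ∖ C₁`);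
* `PrW_defect_le` — hence, with `t ≥ P(a ↮ x)` for every target `a ≠ x`,
  `P(H) ≤ t · P(o ↔ A) + P⊗P{C₁ ∈ hit, ∃ e ∈ Z(C₁) open in C₂}`;
* `prodBernoulli_defect_le` — the same for the product measure `prodBernoulli w` on a finite
  vertex type (`D` = all pairs), in the vocabulary `openConn` of the tree.

The first term is the "first relay pays its own (true) budget" term; the correction is the price
of the closed edges the exploration had to reveal before meeting a relay — it vanishes when `o` is
joined to a relay through edges that are never revealed closed, and in general it is NOT small (it
is the obstruction to removing the `log |A|` in the one-cut / hub form of Kozma–Nitzan gluing by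
revealment alone; see the route notes of `Summits/CriticalPhenomena/PercolationContinuityZ3`, crux
`NoHeavyLowerTail`).  Proofs only (the events `defect`, `connSet`, `corrEvent` are defined in
`TargetExploration.lean`).
-/

noncomputable section

open Classical

namespace Literature.Probability.Percolation

namespace TargetExploration

open Finset DecisionTree Gladkov

variable {V : Type*} [Fintype V] [DecidableEq V]


section Swap

variable {D : Finset (Sym2 V)} {A : Finset V} {o x : V} {p : Sym2 V → ℝ}

/-- **Swap identity for the gluing defect** (Gladkov's Lemma 3.1 along the revealed set of the
stopped exploration): `P(H) = P⊗P{(C₁,C₂) : C₁ →_S C₂ ∈ H}`. [cite: Gladkov2024, Lemma 3.1] -/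
theorem PrW_defect_eq_Pr2W_splice (D : Finset (Sym2 V)) (A : Finset V) (o x : V) (p : Sym2 V → ℝ) :
    PrW D p (defect A o x) =
      Pr2W D p {y | splice (revealedAt D A o y.1) y.1 y.2 ∈ defect A o x} := by
  have h := Pr2W_preimage_swapPair D p (selfDetermined_revealedAt (D := D) (A := A) (o := o))
    (defect A o x ×ˢ (Set.univ : Set (Finset (Sym2 V))))
  rw [Pr2W_prod, PrW_univ, mul_one] at h
  rw [← h]
  congr 1
  ext y
  simp only [Set.mem_preimage, Set.mem_prod, Set.mem_univ, and_true, Set.mem_setOf_eq]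
  rfl

/-- **The revealed closed cut.** If the splice `C₁ →_S C₂` lies in the defect then the exploration of
`C₁` reached a target `a ∈ A` and either `a ↮ x` in `C₂` or some edge revealed closed by the
exploration of `C₁` is open in `C₂`. [folklore] -/
theorem splice_mem_defect {K C₂ : Finset (Sym2 V)} (hK : K ⊆ D) (hC : C₂ ⊆ D)
    (h : splice (revealedAt D A o K) K C₂ ∈ defect A o x) :
    ∃ a ∈ A, K ∈ hitAt D A o a ∧ (C₂ ∉ Gladkov.conn a x ∨ ∃ e ∈ revealedClosed D A o K, e ∈ C₂) := by
  set X := splice (revealedAt D A o K) K C₂ with hX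
  obtain ⟨⟨a₀, ha₀, hXa₀⟩, hXx⟩ := h
  have hXD : X ⊆ D := splice_subset hK hC
  have hhitX : X ∈ hit D A o := mem_hit_of_mem_conn hXD ha₀ hXa₀
  have hhit : K ∈ hit D A o := by
    have hfin := fin_splice (D := D) (A := A) (o := o) K C₂
    simp only [hit, Set.mem_setOf_eq] at hhitX ⊢
    rwa [hfin] at hhitX
  obtain ⟨a, ha, hKa⟩ := mem_hit_iff.1 hhit
  refine ⟨a, ha, hKa, ?_⟩
  by_cases h₂ : C₂ ∈ Gladkov.conn a x
  · right
    refine exists_revealedClosed_of_reachable (Gladkov.mem_conn.1 h₂) fun hax => hXx ?_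
    exact Gladkov.mem_conn.2 ((reachable_splice_of_mem_hitAt hKa C₂).trans hax)
  · exact Or.inl h₂

/-- `Σ_{a ∈ A} P(hitAt a) = P(hit)` (exactly one target is reached on `hit`). [folklore] -/
theorem sum_PrW_hitAt (D : Finset (Sym2 V)) (A : Finset V) (o : V) (p : Sym2 V → ℝ) :
    ∑ a ∈ A, PrW D p (hitAt D A o a) = PrW D p (hit D A o) := by
  simp only [PrW_eq_sum_ind]
  rw [Finset.sum_comm]
  refine Finset.sum_congr rfl fun K _ => ?_
  rw [← Finset.mul_sum]
  congr 1
  by_cases hK : K ∈ hit D A o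
  · obtain ⟨a, ha, hKa⟩ := mem_hit_iff.1 hK
    rw [ind_of_mem hK, Finset.sum_eq_single_of_mem a ha]
    · exact ind_of_mem hKa
    · intro b hb hba
      exact ind_of_not_mem fun hKb => hba (eq_of_mem_hitAt hKb hKa)
  · rw [ind_of_not_mem hK]
    refine Finset.sum_eq_zero fun a ha => ind_of_not_mem fun hKa => hK ?_
    exact mem_hit_iff.2 ⟨a, ha, hKa⟩

/-- `P(hit) = P(o ↔ A)`. [folklore] -/
theorem PrW_hit_eq (D : Finset (Sym2 V)) (A : Finset V) (o : V) (hp0 : ∀ i, 0 ≤ p i)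
    (hp1 : ∀ i, p i ≤ 1) : PrW D p (hit D A o) = PrW D p (connSet A o) :=
  le_antisymm (PrW_mono D hp0 hp1 fun _ hK h => (mem_hit_iff_exists_conn hK).1 h)
    (PrW_mono D hp0 hp1 fun _ hK h => (mem_hit_iff_exists_conn hK).2 h)

/-- **The first-relay revealment bound for the gluing defect.**  If `P(a ↮ x) ≤ t` for every target
`a ≠ x`, then `P({o ↔ A} ∩ {o ↮ x}) ≤ t · P(o ↔ A) + P⊗P(corrEvent)`, where the correction event is
"the exploration of `C₁` stopped at its first target reveals a closed edge that is open in the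
independent copy `C₂`". [folklore] -/
theorem PrW_defect_le (D : Finset (Sym2 V)) (A : Finset V) (o x : V) (hp0 : ∀ i, 0 ≤ p i)
    (hp1 : ∀ i, p i ≤ 1) {t : ℝ} (ht0 : 0 ≤ t) (ht : ∀ a ∈ A, a ≠ x → PrW D p (Gladkov.conn a x)ᶜ ≤ t) :
    PrW D p (defect A o x) ≤ t * PrW D p (connSet A o) + Pr2W D p (corrEvent D A o) := by
  -- the union over the reached target of the product events
  set U : Set (Finset (Sym2 V) × Finset (Sym2 V)) :=
    {y | ∃ a ∈ A, y ∈ hitAt D A o a ×ˢ (Gladkov.conn a x)ᶜ} with hU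
  have hstep1 : PrW D p (defect A o x) ≤ Pr2W D p U + Pr2W D p (corrEvent D A o) := by
    rw [PrW_defect_eq_Pr2W_splice]
    refine (Pr2W_mono D hp0 hp1 ?_).trans (Pr2W_union_le D hp0 hp1 _ _)
    rintro ⟨K, C₂⟩ hK hC h
    obtain ⟨a, ha, hKa, h'⟩ := splice_mem_defect hK hC h
    rcases h' with h' | ⟨e, he, heC⟩
    · exact Or.inl ⟨a, ha, Set.mk_mem_prod hKa h'⟩
    · exact Or.inr ⟨mem_hit_iff.2 ⟨a, ha, hKa⟩, e, he, heC⟩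
  -- union bound over `a`, then independence
  have hstep2 : Pr2W D p U ≤ ∑ a ∈ A, PrW D p (hitAt D A o a) * PrW D p (Gladkov.conn a x)ᶜ := by
    simp only [← Pr2W_prod]
    simp only [Pr2W_eq_sum_ind]
    rw [Finset.sum_comm]
    refine Finset.sum_le_sum fun y _ => ?_
    rw [← Finset.mul_sum]
    refine mul_le_mul_of_nonneg_left ?_ (wt2W_nonneg D hp0 hp1 y)
    by_cases hy : y ∈ U
    · obtain ⟨a, ha, hya⟩ := hy
      rw [ind_of_mem (show y ∈ U from ⟨a, ha, hya⟩)]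
      calc (1 : ℝ) = ind (hitAt D A o a ×ˢ (Gladkov.conn a x)ᶜ) y := (ind_of_mem hya).symm
        _ ≤ ∑ b ∈ A, ind (hitAt D A o b ×ˢ (Gladkov.conn b x)ᶜ) y :=
            Finset.single_le_sum (f := fun b => ind (hitAt D A o b ×ˢ (Gladkov.conn b x)ᶜ) y)
              (fun b _ => ind_nonneg _ y) ha
    · rw [ind_of_not_mem hy]
      exact Finset.sum_nonneg fun b _ => ind_nonneg _ y
  -- each term is at most `t · P(hitAt a)` (for `a = x` the product event is empty)
  have hstep3 : ∑ a ∈ A, PrW D p (hitAt D A o a) * PrW D p (Gladkov.conn a x)ᶜ ≤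
      t * PrW D p (connSet A o) := by
    rw [← PrW_hit_eq D A o hp0 hp1, ← sum_PrW_hitAt D A o p, Finset.mul_sum]
    refine Finset.sum_le_sum fun a ha => ?_
    rw [mul_comm t]
    by_cases hax : a = x
    · subst hax
      have h0 : PrW D p (Gladkov.conn a a)ᶜ = 0 := by
        rw [PrW_eq_sum_ind]
        refine Finset.sum_eq_zero fun K _ => ?_
        have hK : K ∉ (Gladkov.conn a a)ᶜ := fun h => h (Gladkov.mem_conn.2 (SimpleGraph.Reachable.refl a))
        rw [ind_of_not_mem hK, mul_zero]
      rw [h0, mul_zero]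
      exact mul_nonneg (PrW_nonneg D hp0 hp1 _) ht0
    · exact mul_le_mul_of_nonneg_left (ht a ha hax) (PrW_nonneg D hp0 hp1 _)
  linarith

end Swap

/-! ### The same for the product measure `prodBernoulli w` on a finite vertex type -/

section Measure

open MeasureTheory Literature.Probability.LatticeModels

variable (w : Sym2 V → unitInterval) (A : Finset V) (o x : V)

omit [DecidableEq V] in
/-- Every event is determined by all the coordinates. [folklore] -/
theorem determinedBy_univ (C : Set (BondConfig V)) :
    DeterminedBy C (↑(Finset.univ : Finset (Sym2 V)) : Set (Sym2 V)) := by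
  rw [determinedBy_iff]
  intro ω ω' h
  rw [Finset.coe_univ, Set.inter_univ, Set.inter_univ] at h
  rw [h]

/-- The gluing defect `{o ↔ A} ∩ {o ↮ x}` under `prodBernoulli w` is the finitary `PrW` of `defect`.
[folklore] -/
theorem prodBernoulli_real_defect :
    (prodBernoulli w).real ((⋃ a ∈ A, openConn o a) ∩ (openConn o x)ᶜ) =
      PrW Finset.univ (fun e => (w e : ℝ)) (defect A o x) := by
  refine DecisionTree.prodBernoulli_real_eq_PrW w (determinedBy_univ _) fun S _ => ?_
  simp only [defect, Set.mem_setOf_eq, Set.mem_inter_iff, Set.mem_iUnion, Set.mem_compl_iff,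
    exists_prop]
  rfl

/-- `{o ↔ A}` under `prodBernoulli w` is the finitary `PrW` of `connSet`. [folklore] -/
theorem prodBernoulli_real_connSet :
    (prodBernoulli w).real (⋃ a ∈ A, openConn o a) = PrW Finset.univ (fun e => (w e : ℝ)) (connSet A o) := by
  refine DecisionTree.prodBernoulli_real_eq_PrW w (determinedBy_univ _) fun S _ => ?_
  simp only [connSet, Set.mem_setOf_eq, Set.mem_iUnion, exists_prop]
  rfl

/-- `{a ↮ x}` under `prodBernoulli w` is the finitary `PrW` of `(conn a x)ᶜ`. [folklore] -/
theorem prodBernoulli_real_compl_conn (a : V) :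
    (prodBernoulli w).real (openConn a x)ᶜ = PrW Finset.univ (fun e => (w e : ℝ)) (Gladkov.conn a x)ᶜ :=
  DecisionTree.prodBernoulli_real_eq_PrW w (determinedBy_univ _) fun _ _ => Iff.rfl

/-- **Swap identity for the gluing defect, measure form**: for bond percolation `prodBernoulli w`
on a finite vertex type, `P({o ↔ A} ∩ {o ↮ x}) = P⊗P{(C₁, C₂) : C₁ →_S C₂ ∈ defect}`, `S = S(C₁)`
the revealed set of the exploration of the cluster of `o` stopped at its first target.
[cite: Gladkov2024, Lemma 3.1] -/
theorem prodBernoulli_defect_eq_Pr2W_splice :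
    (prodBernoulli w).real ((⋃ a ∈ A, openConn o a) ∩ (openConn o x)ᶜ) =
      Pr2W Finset.univ (fun e => (w e : ℝ))
        {y | splice (revealedAt Finset.univ A o y.1) y.1 y.2 ∈ defect A o x} := by
  rw [prodBernoulli_real_defect, PrW_defect_eq_Pr2W_splice]

/-- **First-relay revealment bound, measure form**: if `P(a ↮ x) ≤ t` for every target `a ≠ x`
(`t ≥ 0`), then `P({o ↔ A} ∩ {o ↮ x}) ≤ t · P(o ↔ A) + P⊗P(corrEvent)`, the correction being the
pair-probability that the exploration of `C₁` stopped at its first target has revealed a closed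
edge that is open in the independent copy `C₂`. [folklore] -/
theorem prodBernoulli_defect_le {t : ℝ} (ht0 : 0 ≤ t)
    (ht : ∀ a ∈ A, a ≠ x → (prodBernoulli w).real (openConn a x)ᶜ ≤ t) :
    (prodBernoulli w).real ((⋃ a ∈ A, openConn o a) ∩ (openConn o x)ᶜ) ≤
      t * (prodBernoulli w).real (⋃ a ∈ A, openConn o a) +
        Pr2W Finset.univ (fun e => (w e : ℝ)) (corrEvent Finset.univ A o) := by
  rw [prodBernoulli_real_defect, prodBernoulli_real_connSet]
  have hp0 : ∀ e : Sym2 V, 0 ≤ (fun e => (w e : ℝ)) e := fun e => (w e).2.1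
  have hp1 : ∀ e : Sym2 V, (fun e => (w e : ℝ)) e ≤ 1 := fun e => (w e).2.2
  refine PrW_defect_le Finset.univ A o x hp0 hp1 ht0 fun a ha hax => ?_
  rw [← prodBernoulli_real_compl_conn]
  exact ht a ha hax

omit [Fintype V] in
/-- `Pr2W` as an iterated sum: first configuration, then the `PrW`-probability of the slice.
[folklore] -/
theorem Pr2W_eq_sum_mul_PrW (D : Finset (Sym2 V)) (p : Sym2 V → ℝ)
    (Y : Set (Finset (Sym2 V) × Finset (Sym2 V))) :
    Pr2W D p Y = ∑ S ∈ D.powerset, wtW D p S * PrW D p {T | (S, T) ∈ Y} := by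
  unfold Pr2W PrW wt2W
  rw [Finset.sum_product]
  refine Finset.sum_congr rfl fun S _ => ?_
  rw [Finset.mul_sum]
  refine Finset.sum_congr rfl fun T _ => ?_
  by_cases h : (S, T) ∈ Y
  · rw [Set.indicator_of_mem h, Set.indicator_of_mem (show T ∈ {T | (S, T) ∈ Y} from h)]
  · rw [Set.indicator_of_notMem h, Set.indicator_of_notMem (show T ∉ {T | (S, T) ∈ Y} from h),
      mul_zero]

/-- **The correction term is the expected open-weight of the revealed closed cut**: 
`P⊗P(corrEvent) ≤ Σ_K wt(K) · 1[K ∈ hit] · Σ_{e ∈ Z(K)} w e` (union bound in the second copy).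
[folklore] -/
theorem Pr2W_corrEvent_le :
    Pr2W Finset.univ (fun e => (w e : ℝ)) (corrEvent Finset.univ A o) ≤
      ∑ K ∈ (Finset.univ : Finset (Sym2 V)).powerset, wtW Finset.univ (fun e => (w e : ℝ)) K *
        ((hit Finset.univ A o).indicator (fun _ => (1 : ℝ)) K *
          ∑ e ∈ revealedClosed Finset.univ A o K, (w e : ℝ)) := by
  have hp0 : ∀ e : Sym2 V, 0 ≤ (fun e => (w e : ℝ)) e := fun e => (w e).2.1
  have hp1 : ∀ e : Sym2 V, (fun e => (w e : ℝ)) e ≤ 1 := fun e => (w e).2.2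
  rw [Pr2W_eq_sum_mul_PrW]
  refine Finset.sum_le_sum fun K _ => mul_le_mul_of_nonneg_left ?_ (wtW_nonneg _ hp0 hp1 K)
  by_cases hK : K ∈ hit Finset.univ A o
  · rw [Set.indicator_of_mem hK, one_mul]
    have hset : {T : Finset (Sym2 V) | (K, T) ∈ corrEvent Finset.univ A o} =
        {T | ∃ e ∈ revealedClosed Finset.univ A o K, e ∈ T} := by
      ext T
      simp only [corrEvent, Set.mem_setOf_eq]
      exact ⟨fun h => h.2, fun h => ⟨hK, h⟩⟩
    rw [hset, ← DecisionTree.prodBernoulli_real_eq_PrW w (determinedBy_univ _)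
      (C := {ω : Set (Sym2 V) | ∃ e ∈ revealedClosed Finset.univ A o K, e ∈ ω})
      (fun S _ => by simp only [Set.mem_setOf_eq, Finset.mem_coe])]
    exact prodBernoulli_real_exists_mem_le_sum w _
  · rw [Set.indicator_of_notMem hK, zero_mul]
    have hset : {T : Finset (Sym2 V) | (K, T) ∈ corrEvent Finset.univ A o} = ∅ := by
      ext T
      simp only [corrEvent, Set.mem_setOf_eq, Set.mem_empty_iff_false, iff_false, not_and]
      exact fun h => absurd h hK
    rw [hset]
    unfold PrW
    simp

/-- **First-relay revealment bound, expected-cut form**: with `t ≥ P(a ↮ x)` for all targets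
`a ≠ x`, `P({o ↔ A} ∩ {o ↮ x}) ≤ t · P(o ↔ A) + E[1{hit} · Σ_{e ∈ Z} w e]`, `Z` the set of edges
revealed closed by the exploration of the cluster of `o` before its first target. [folklore] -/
theorem prodBernoulli_defect_le_sum {t : ℝ} (ht0 : 0 ≤ t)
    (ht : ∀ a ∈ A, a ≠ x → (prodBernoulli w).real (openConn a x)ᶜ ≤ t) :
    (prodBernoulli w).real ((⋃ a ∈ A, openConn o a) ∩ (openConn o x)ᶜ) ≤
      t * (prodBernoulli w).real (⋃ a ∈ A, openConn o a) +
        ∑ K ∈ (Finset.univ : Finset (Sym2 V)).powerset, wtW Finset.univ (fun e => (w e : ℝ)) K *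
          ((hit Finset.univ A o).indicator (fun _ => (1 : ℝ)) K *
            ∑ e ∈ revealedClosed Finset.univ A o K, (w e : ℝ)) :=
  (prodBernoulli_defect_le w A o x ht0 ht).trans (by
    have h := Pr2W_corrEvent_le w A o
    linarith)

end Measure

end TargetExploration

end Literature.Probability.Percolation

end
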